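import Summits.QuantumAdvantage.QuantumAdvantage.Theses.DarkClassGroups
import Summits.QuantumAdvantage.QuantumAdvantage.Theorems.DarkClassGroupsPrimeClassesSpreadInputs
import Literature.Computability.Cryptography.HallgrenClassGroupDiscriminant
import Literature.NumberTheory.QuadraticFields.ImaginaryResidueClassNumber
import Literature.NumberTheory.QuadraticFields.ImaginaryQuadraticPrescribedSplitting
import Literature.NumberTheory.LFunctions.SiegelTheorem
import HarnessLib

/-!
# Crux `NoSiegelBright` (stmt-QuantumAdvantage-17901, route `DarkClassGroups`): PROVED — where GRH is
# replaced by hypothesis (i) in the Hallgren programme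

Topic `Summits/QuantumAdvantage/QuantumAdvantage/Theorems`; closes the crux
`Summit.QuantumAdvantage.QuantumAdvantage.Theses.DarkClassGroups.NoSiegelBright` BY NAME, via the three
registered stubs of the line `no-siegel-bright` (skeleton `Cruxes/ClassNumberFBQP/Lines/no_siegel_bright.lean`,
planner-cstrat-stmt-QuantumAdvantage-11623-r1-0), each proved here with its registered signature:

* `stub_oddPrimitiveKronecker` (S1) — for `−d` fundamental and `K` quadratic of discriminant `−d`: a primitive
  quadratic ODD Dirichlet character `κ ≠ 1` mod `d` with `Re L(1, κ) = κ_K`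
  (`PrimeClassesSpread.exists_oddKroneckerChar` + `Quadratic.LFunction_one_eq_dedekindZeta_residue_of_eq`);
* `stub_residue_lower_of_zeroFree` (S2) — effective Hecke–Landau: a quadratic `κ ≠ 1` mod `d ≥ 3` with no real
  zero of `L(s, κ)` in `σ > 1 − c/log d` has `Re L(1, κ) ≥ c'/log d`, `c' = c_E · min(log 3/4, c/2) · e^{−E₀}`
  (Montgomery–Vaughan Thm 11.14 Case A, `Siegel.caseA`, with `η = min(1/4, c/(2 log d))`);
* `stub_bright_classNumber_of_residue` (S3) — residue brightness ⇒ class-number brightness,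
  `C = ⌈π/c⌉₊` (class number formula `Quadratic.le_classNumber_of_dedekindZeta_residue_ge`,
  `IsNegFundamentalDiscr.classNumber_eq`, `exists_numberField`);
* `noSiegelBright_proof` — the composition `NoSiegelBright_of` of the skeleton, retargeted to the route decl.

HONEST FRAMING: the value of this file is a THEOREM (kernel-checked; the statement's own antecedent (i)
`NoSiegelZerosOddQuadratic` is an open conjecture and stays a hypothesis) — not summit progress.
-/

noncomputable section

open scoped NumberField
open Literature.NumberTheory.LFunctions Literature.NumberTheory.QuadraticFields
  Literature.NumberTheory.QuadraticFields.Quadratic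
open Literature.Computability.Cryptography (IsNegFundamentalDiscr)

namespace Summit.QuantumAdvantage.QuantumAdvantage.Theorems.NoSiegelBright

/-! ### S1 — the odd primitive Kronecker character and `Re L(1, κ) = κ_K` -/

/-- **S1 `stub_oddPrimitiveKronecker`** (registered signature): for `−d` a negative fundamental
discriminant and `K` a quadratic field of discriminant `−d`, there is a primitive quadratic odd Dirichlet
character `κ ≠ 1` modulo `d` with `Re L(1, κ) = κ_K`. [cite: MontgomeryVaughan2007, Theorem 9.13; §10.1 Exercise 26] -/
theorem stub_oddPrimitiveKronecker : ∀ (d : ℕ) [NeZero d],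
    Literature.Computability.Cryptography.IsNegFundamentalDiscr d →
    ∀ (K : Type) [Field K] [NumberField K], Module.finrank ℚ K = 2 → NumberField.discr K = -(d : ℤ) →
      ∃ κ : DirichletCharacter ℂ d, κ ≠ 1 ∧ κ.IsQuadratic ∧ κ.IsPrimitive ∧ κ.Odd ∧
        (κ.LFunction 1).re = NumberField.dedekindZeta_residue K := by
  intro d _ hd K _ _ h2 hK
  have hneg : NumberField.discr K < 0 := by rw [hK]; exact hd.neg_lt_zero
  have hc : NumberField.IsTotallyComplex K := isTotallyComplex_of_discr_neg h2 hneg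
  obtain ⟨M, _, κ, hM, hκ1, hquad, hprim, hodd, hfac⟩ :=
    PrimeClassesSpread.exists_oddKroneckerChar K h2 hc
  have hMd : M = d := by
    rw [hM, hK, Int.natAbs_neg, Int.natAbs_natCast]
  subst hMd
  refine ⟨κ, hκ1, hquad, hprim, hodd, ?_⟩
  have h1 : κ.LFunction 1 = (NumberField.dedekindZeta_residue K : ℂ) :=
    LFunction_one_eq_dedekindZeta_residue_of_eq (K := K) hκ1 fun s hs ↦
      hfac (s : ℂ) (by simpa using hs)
  rw [h1, Complex.ofReal_re]

/-! ### S2 — effective Hecke–Landau (MV Theorem 11.14, Case A) -/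

/-- **S2 `stub_residue_lower_of_zeroFree`** (registered signature): for every `c > 0` there is `c' > 0`
such that every quadratic Dirichlet character `κ ≠ 1` modulo `d ≥ 3` whose `L(s, κ)` has no real zero in
`σ > 1 − c/log d` satisfies `Re L(1, κ) ≥ c'/log d`.  With `η = min(1/4, c/(2 log d))` the interval
`[1 − η, 1)` lies inside the zero-free range, Case A gives `Re L(1, κ) ≥ c_E η (B d)^{−A_E η}`, and
`η ≥ c₁/log d`, `A_E η log(B d) ≤ E₀` with `c₁ = min(log 3/4, c/2)`, `E₀ = A_E (log B/4 + c/2)`.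
[cite: MontgomeryVaughan2007, §11.2 Theorem 11.14 (Case A)] -/
theorem stub_residue_lower_of_zeroFree : ∀ c : ℝ, 0 < c → ∃ c' : ℝ, 0 < c' ∧
    ∀ (d : ℕ) [NeZero d], 3 ≤ d → ∀ κ : DirichletCharacter ℂ d, κ ≠ 1 → κ ^ 2 = 1 →
      (∀ σ : ℝ, 1 - c / Real.log d < σ → κ.LFunction σ ≠ 0) → c' / Real.log d ≤ (κ.LFunction 1).re := by
  intro c hc
  have hA := Estermann.estermannA_pos
  have hC := Estermann.estermannC_pos
  have hB1 := Siegel.one_le_ballConst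
  have hLB0 : 0 ≤ Real.log Siegel.ballConst := Real.log_nonneg hB1
  have hlog3 : 0 < Real.log 3 := Real.log_pos (by norm_num)
  set c₁ : ℝ := min (Real.log 3 / 4) (c / 2) with hc₁
  have hc₁0 : 0 < c₁ := lt_min (by positivity) (by positivity)
  set E₀ : ℝ := Estermann.estermannA * (Real.log Siegel.ballConst / 4 + c / 2) with hE₀
  refine ⟨Estermann.estermannC * c₁ * Real.exp (-E₀), mul_pos (mul_pos hC hc₁0) (Real.exp_pos _),
    fun d _ hd κ hκ1 hκ2 hzf ↦ ?_⟩
  have hdr : (3 : ℝ) ≤ d := by exact_mod_cast hd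
  have hlogd : Real.log 3 ≤ Real.log d := Real.log_le_log (by norm_num) hdr
  have hlogd0 : 0 < Real.log d := hlog3.trans_le hlogd
  -- the width `η`
  set η : ℝ := min (1 / 4) (c / (2 * Real.log d)) with hη
  have hη0 : 0 < η := lt_min (by norm_num) (by positivity)
  have hη4 : η ≤ 1 / 4 := min_le_left _ _
  have hη2 : η ≤ c / (2 * Real.log d) := min_le_right _ _
  have hηc : η < c / Real.log d := hη2.trans_lt (by
    rw [div_lt_div_iff₀ (by positivity) hlogd0]; nlinarith)
  have hηlow : c₁ / Real.log d ≤ η := by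
    refine le_min ?_ ?_
    · rw [div_le_iff₀ hlogd0]
      linarith [min_le_left (Real.log 3 / 4) (c / 2)]
    · rw [div_le_div_iff₀ hlogd0 (by positivity)]
      calc c₁ * (2 * Real.log d) ≤ c / 2 * (2 * Real.log d) :=
            mul_le_mul_of_nonneg_right (min_le_right _ _) (by positivity)
        _ = c * Real.log d := by ring
  -- zero-free on `[1 − η, 1)`
  have hz : ∀ σ : ℝ, 1 - η ≤ σ → σ < 1 → κ.LFunction σ ≠ 0 :=
    fun σ hσ _ ↦ hzf σ (by linarith)
  have key := Siegel.caseA κ hκ1 hκ2 hη0 hη4 hz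
  refine le_trans ?_ key
  -- `c'/log d ≤ c_E η (B d)^{−A_E η}`
  have hBq0 : 0 < Siegel.ballConst * d := by positivity
  have hexp : (Siegel.ballConst * d) ^ (-Estermann.estermannA * η) =
      Real.exp (-(Estermann.estermannA * (η * Real.log Siegel.ballConst + η * Real.log d))) := by
    rw [Real.rpow_def_of_pos hBq0, Real.log_mul (by positivity) (by positivity)]
    congr 1; ring
  have e1 : η * Real.log Siegel.ballConst ≤ 1 / 4 * Real.log Siegel.ballConst :=
    mul_le_mul_of_nonneg_right hη4 hLB0
  have e4 : η * Real.log d ≤ c / (2 * Real.log d) * Real.log d :=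
    mul_le_mul_of_nonneg_right hη2 hlogd0.le
  have e6 : c / (2 * Real.log d) * Real.log d = c / 2 := by field_simp
  have hsum : Estermann.estermannA * (η * Real.log Siegel.ballConst + η * Real.log d) ≤ E₀ := by
    rw [hE₀]
    exact mul_le_mul_of_nonneg_left (by linarith) hA.le
  calc Estermann.estermannC * c₁ * Real.exp (-E₀) / Real.log d
      = Estermann.estermannC * (c₁ / Real.log d) * Real.exp (-E₀) := by ring
    _ ≤ Estermann.estermannC * η *
        Real.exp (-(Estermann.estermannA * (η * Real.log Siegel.ballConst + η * Real.log d))) :=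
        mul_le_mul (mul_le_mul_of_nonneg_left hηlow hC.le) (Real.exp_le_exp.mpr (by linarith))
          (by positivity) (by positivity)
    _ = Estermann.estermannC * η * (Siegel.ballConst * d) ^ (-Estermann.estermannA * η) := by
        rw [hexp]

/-! ### S3 — residue brightness ⇒ class-number brightness (class number formula) -/

/-- **S3 `stub_bright_classNumber_of_residue`** (registered signature): if `κ_K ≥ c/log d` for the
quadratic fields `K` of discriminant `−d` (`−d` fundamental), then `√d ≤ C · h(−d) · log d` with
`C = ⌈π/c⌉₊`: `c √d/(π log d) ≤ h_K = h(−d)`. [cite: DavenportMNT1980, Ch. 6 (class number formula for d < 0)] -/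
theorem stub_bright_classNumber_of_residue : ∀ c : ℝ, 0 < c → ∃ C : ℕ, ∀ d : ℕ,
    Literature.Computability.Cryptography.IsNegFundamentalDiscr d →
    (∀ (K : Type) [Field K] [NumberField K], Module.finrank ℚ K = 2 → NumberField.discr K = -(d : ℤ) →
      c / Real.log d ≤ NumberField.dedekindZeta_residue K) →
    Real.sqrt (d : ℝ) ≤ (C : ℝ) *
      (Literature.NumberTheory.QuadraticFields.BinaryQuadraticForm.classNumber (-(d : ℤ)) : ℝ) *
        Real.log (d : ℝ) := by
  intro c hc
  refine ⟨⌈Real.pi / c⌉₊, fun d hd hres ↦ ?_⟩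
  obtain ⟨K, _, _, h2, hK⟩ := hd.exists_numberField
  have hκ := hres K h2 hK
  have hh := le_classNumber_of_dedekindZeta_residue_ge (K := K) h2 hK hκ
  rw [← hd.classNumber_eq h2 hK] at hh
  have hdr : (3 : ℝ) ≤ d := by exact_mod_cast hd.three_le
  have hlogd : 0 < Real.log d := Real.log_pos (by linarith)
  have hpi : 0 < Real.pi := Real.pi_pos
  set h : ℝ := (Literature.NumberTheory.QuadraticFields.BinaryQuadraticForm.classNumber (-(d : ℤ)) : ℝ)
    with hhdef
  have hh0 : 0 ≤ h := Nat.cast_nonneg _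
  -- `√d ≤ (π/c) h log d ≤ ⌈π/c⌉ h log d`
  have h1 : Real.sqrt d ≤ Real.pi / c * h * Real.log d := by
    have := (div_le_iff₀ (by positivity)).1 hh
    have e : Real.pi / c * h * Real.log d = h * (Real.pi * Real.log d) / c := by ring
    rw [e, le_div_iff₀ hc]
    linarith
  have h2' : Real.pi / c * h * Real.log d ≤ (⌈Real.pi / c⌉₊ : ℝ) * h * Real.log d := by
    have := Nat.le_ceil (Real.pi / c)
    have hhl : 0 ≤ h * Real.log d := mul_nonneg hh0 hlogd.le
    nlinarith
  linarith

/-! ### The crux -/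

/-- **`NoSiegelBright` (stmt-QuantumAdvantage-17901), PROVED**: hypothesis (i) `NoSiegelZerosOddQuadratic` ⇒
there is `C : ℕ` with `√d ≤ C · h(−d) · log d` for every negative fundamental discriminant `−d`
(the composition `NoSiegelBright_of` of the line skeleton: (i) gives `c`; S2 gives `c'`; S3 gives `C`; S1's
character is odd, primitive, quadratic mod `d ≥ 3`, so (i) makes `L(s, κ)` zero-free on `σ > 1 − c/log d`,
S2 bounds `Re L(1, κ) = κ_K`, S3 concludes). -/
theorem noSiegelBright_proof :
    Summit.QuantumAdvantage.QuantumAdvantage.Theses.DarkClassGroups.NoSiegelBright := by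
  intro hNSZ
  obtain ⟨c, hc, hzf⟩ := hNSZ
  obtain ⟨c', hc', hlow⟩ := stub_residue_lower_of_zeroFree c hc
  obtain ⟨C, hC⟩ := stub_bright_classNumber_of_residue c' hc'
  refine ⟨C, fun d hd => hC d hd ?_⟩
  intro K _ _ h2K hdisc
  have hd' : Literature.Computability.Cryptography.IsNegFundamentalDiscr d := hd
  haveI : NeZero d := ⟨hd'.ne_zero⟩
  obtain ⟨κ, hκ1, hκq, hκp, hκo, hκres⟩ := stub_oddPrimitiveKronecker d hd' K h2K hdisc
  have hz : ∀ σ : ℝ, 1 - c / Real.log d < σ → κ.LFunction σ ≠ 0 :=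
    fun σ hσ => hzf d hd'.three_le κ hκq hκp hκo σ hσ
  rw [← hκres]
  exact hlow d hd'.three_le κ hκ1 hκq.sq_eq_one hz

end Summit.QuantumAdvantage.QuantumAdvantage.Theorems.NoSiegelBright

end
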